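import Literature.NumberTheory.EllipticCurves.KubertTateFiveMinimalModel
import Literature.NumberTheory.EllipticCurves.KubertTateSevenRational
import HarnessLib

/-!
# Every elliptic curve over `ℚ` with a rational point of order `5` is an `E_{m,n} = [n − m, −mn, −mn², 0, 0]`
# with `m, n` coprime — a GLOBAL MINIMAL MODEL

PROOF-ONLY file (theorems only), topic `NumberTheory/EllipticCurves`; the `X₁(5)`-analogue of
`KubertTateSevenRational`. It combines the universality of the Tate normal form `E(t, t)` (Knapp (5.31), tree
`exists_variableChange_eq_kubertTate_self_of_addOrderOf_eq_five'`, file `KubertTateFive`), the scaling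
`kubertTateFive m n = (u = n⁻¹) • E(m/n, m/n)` (`kubertTateFive_eq_variableChange_kubertTate`) with `t = m/n`
in lowest terms, and the global minimality of the coprime integral model (`KubertTateFiveMinimalModel`):

* **`exists_variableChange_eq_kubertTateFive_of_addOrderOf_eq_five`** — for any Weierstrass curve `W/ℚ` and
  a point `P ∈ W(ℚ)` of order `5` there are COPRIME integers `m, n`, both nonzero, and an admissible change of
  variables `C` over `ℚ` with `C • W = E_{m,n} = [n − m, −mn, −mn², 0, 0]`;
* **`exists_globallyMinimal_kubertTateFive_model`** — the same model is a GLOBAL MINIMAL MODEL of `W`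
  (`isGloballyMinimal_kubertTateFive_of_isCoprime`): every elliptic curve over `ℚ` with a rational `5`-torsion
  point has a global minimal model of Kubert–Tate shape, so its reduction types and `a_p` are read off
  `[n − m, −mn, −mn², 0, 0]`;
* **`exists_kubertTateFive_model`** — the model has the SAME Mordell–Weil rank and the same vanishing of every
  `t_p = corank_{ℤ_p} Ш[p^∞]` (transport along `C`, tree `shaCorank_eq_zero_iff_of_smul_eq`,
  `mordellWeilRank_eq_of_smul_eq`): the class-wide `5`-descent of `KubertTateFiveMuDescent[Box]` (Fisher 2001)
  is a statement about ALL elliptic curves over `ℚ` with a rational point of order `5`.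

## References

* [Kubert1976] D. S. Kubert, *Universal bounds on the torsion of elliptic curves*, Proc. London Math. Soc. (3)
  33 (1976) 193–237, Table 3 (`N = 5`).
* [Knapp1993] A. W. Knapp, *Elliptic Curves*, §V.5 (5.31).
* [SilvermanAEC2009] J. H. Silverman, *AEC*, 2nd ed., III.1 Table 3.1, III.3.1(b), VII.1 Rem. 1.1, VIII.8,
  X.§4 Rem. 4.1.1.
* [Fisher2001FiveSevenDescent] T. Fisher, JEMS 3 (2001) 169–201, §§1–2.
-/

noncomputable section

open scoped Classical

namespace WeierstrassCurve

open Literature.NumberTheory.EllipticCurves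

/-- **Every curve over `ℚ` with a rational point of order `5` is `ℚ`-isomorphic to an integral Kubert–Tate
model `E_{m,n} = [n − m, −mn, −mn², 0, 0]` with `m, n` coprime and nonzero** (`t = m/n` in lowest terms in
Knapp's `E(t, t)`, then the scaling `u = n⁻¹`). [cite: Kubert1976, Table 3 (N = 5)] [cite: Knapp1993, §V.5 (5.31)]
[cite: SilvermanAEC2009, III.1 Table 3.1] -/
theorem exists_variableChange_eq_kubertTateFive_of_addOrderOf_eq_five (W : WeierstrassCurve ℚ)
    (P : W.toAffine.Point) (h5 : addOrderOf P = 5) :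
    ∃ (m n : ℤ) (C : VariableChange ℚ), C • W = kubertTateFive (m : ℚ) (n : ℚ) ∧ IsCoprime m n ∧
      m ≠ 0 ∧ n ≠ 0 := by
  obtain ⟨t, C₁, hC₁, -, ht0, -⟩ := exists_variableChange_eq_kubertTate_self_of_addOrderOf_eq_five' W P h5
  set m : ℤ := t.num with hm
  set n : ℤ := (t.den : ℤ) with hn
  have hn0 : n ≠ 0 := by rw [hn]; exact_mod_cast t.den_ne_zero
  have hn0' : (n : ℚ) ≠ 0 := by exact_mod_cast hn0
  have ht : t = (m : ℚ) / (n : ℚ) := by rw [hm, hn]; exact (Rat.num_div_den t).symm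
  have hm0 : m ≠ 0 := by
    intro h0
    apply ht0
    rw [ht, h0, Int.cast_zero, zero_div]
  have hcop : IsCoprime m n := by
    rw [hm, hn, Int.isCoprime_iff_gcd_eq_one]
    exact_mod_cast t.reduced
  set C₂ : VariableChange ℚ := ⟨(Units.mk0 (n : ℚ) hn0')⁻¹, 0, 0, 0⟩ with hC₂
  refine ⟨m, n, C₂ * C₁, ?_, hcop, hm0, hn0⟩
  rw [mul_smul, hC₁, kubertTateFive_eq_variableChange_kubertTate hn0', ← ht]

/-- **Every curve over `ℚ` with a rational point of order `5` has a GLOBAL MINIMAL MODEL of Kubert–Tate shape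
`E_{m,n} = [n − m, −mn, −mn², 0, 0]`** (`m, n` coprime and nonzero): the model of
`exists_variableChange_eq_kubertTateFive_of_addOrderOf_eq_five` is globally minimal by
`isGloballyMinimal_kubertTateFive_of_isCoprime`. [cite: SilvermanAEC2009, VIII.8 and VII.1 Remark 1.1]
[cite: Kubert1976, Table 3 (N = 5)] -/
theorem exists_globallyMinimal_kubertTateFive_model (W : WeierstrassCurve ℚ) (P : W.toAffine.Point)
    (h5 : addOrderOf P = 5) :
    ∃ (m n : ℤ) (C : VariableChange ℚ), C • W = kubertTateFive (m : ℚ) (n : ℚ) ∧ IsCoprime m n ∧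
      m ≠ 0 ∧ n ≠ 0 ∧ (kubertTateFive (m : ℚ) (n : ℚ)).IsGloballyMinimal := by
  obtain ⟨m, n, C, hC, hcop, hm, hn⟩ := exists_variableChange_eq_kubertTateFive_of_addOrderOf_eq_five W P h5
  exact ⟨m, n, C, hC, hcop, hm, hn, isGloballyMinimal_kubertTateFive_of_isCoprime m n hcop⟩

/-- **Every elliptic curve over `ℚ` with a rational point of order `5` has an integral Kubert–Tate model
`E_{m,n}` (`m, n` coprime and nonzero, globally minimal) with the same Mordell–Weil rank and the same vanishing
of `t_p = corank_{ℤ_p} Ш[p^∞]` at every prime `p`** — so the class-wide `5`-descent on the family `E_{m,n}`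
(`KubertTateFiveMuDescent`, `KubertTateFiveMuDescentBox`) speaks about every such curve.
[cite: Kubert1976, Table 3 (N = 5)] [cite: Fisher2001FiveSevenDescent, §§1–2]
[cite: SilvermanAEC2009, III.3.1(b) and X.§4 Rem. 4.1.1] -/
theorem exists_kubertTateFive_model (W : WeierstrassCurve ℚ) [W.IsElliptic] (P : W.toAffine.Point)
    (h5 : addOrderOf P = 5) :
    ∃ (m n : ℤ) (_ : (kubertTateFive (m : ℚ) (n : ℚ)).IsElliptic), IsCoprime m n ∧ m ≠ 0 ∧ n ≠ 0 ∧
      (kubertTateFive (m : ℚ) (n : ℚ)).IsGloballyMinimal ∧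
      W.mordellWeilRank = (kubertTateFive (m : ℚ) (n : ℚ)).mordellWeilRank ∧
      ∀ (p : ℕ) [Fact p.Prime], W.shaCorank p = 0 ↔ (kubertTateFive (m : ℚ) (n : ℚ)).shaCorank p = 0 := by
  obtain ⟨m, n, C, hC, hcop, hm0, hn0, hmin⟩ := exists_globallyMinimal_kubertTateFive_model W P h5
  haveI hE : (kubertTateFive (m : ℚ) (n : ℚ)).IsElliptic := by rw [← hC]; infer_instance
  exact ⟨m, n, hE, hcop, hm0, hn0, hmin, mordellWeilRank_eq_of_smul_eq W _ C hC,
    fun p _ ↦ shaCorank_eq_zero_iff_of_smul_eq W _ C hC p⟩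

end WeierstrassCurve

end
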